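import Summits.PneNP.PneNP.Theorems.SmallBlockRothvossBallGridBound
import Summits.PneNP.MatchingPsdRank.Conjectures.MatchingSmallBlockPsdBound
import HarnessLib

/-!
# Block psd lifts of the perfect matching polytope: the fixed-block rung leaf F-N2.SOCb (cell pnp-psdrank)

Landing file 7 (pnp-psdrank-eng g4): the by-name closer of the rung leaf
`Summit.PneNP.MatchingPsdRank.MatchingBlockPsdBound` (typed by pnp-psdrank-p2, landed by pnp-psdrank-lit,
p417221; alt-closer F-N2.SOCb): for every block size `b ≥ 1` there are `α > 0` and `n₀` such that every
`(S^b_+)^m` factorization of the odd-cut slack matrix of `P_PM(n)` (`n ≥ n₀` even) has `2^{α n} ≤ m`. It follows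
from the explicit polynomial-in-`b` bound `blockPsd_explicit` (`2^{δ_R n/(798(b+1))} ≤ m · 14400 b⁵ n³`, file
`SmallBlockRothvossBallGridBound`) with `α_b = δ_R/(1596(b+1))` by exponential-versus-polynomial arithmetic.
(The cell's first kernel proof of this leaf, pnp-psdrank-eng g3's `SocLiftB.lean`, gives
`α_b = δ_R/(798(b+1)(2b+3))`; its tree chain is `SmallBlockRothvossGridNet` / `…AccountingB` / `…Face`.)
[cite: Rothvoss2017, Thm. 1] [cite: FawziParrilo2013, §1.2 (the COR analogue)]
WHAT THIS IS NOT: not a bound on general psd rank / SDP extension complexity of matching (rung F-N2 stays open: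
a single block of dimension `≳ n/log n` escapes every statement of this family); nothing P ≠ NP-relevant.
-/

set_option linter.dupNamespace false -- `Summit.PneNP.PneNP.…`: summit = sub-problem (D-0017)

noncomputable section

open Finset Real Literature.Barriers.PneNP Literature.Combinatorics.Optimization

namespace Summit.PneNP.PneNP.Theorems.SmallBlockRothvossBallGrid

/-- **Rung leaf F-N2.SOCb, closed by name: fixed-block psd lifts of the perfect matching polytope are
exponential.** For every `b ≥ 1`, with `α_b = δ_R/(1596(b+1))`: every `(S^b_+)^m` factorization of the
odd-cut slack matrix of `P_PM(n)`, `n ≥ n₀(b)` even, has `m ≥ 2^{α_b n}`. From `blockPsd_explicit`. (At `b = 2`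
this re-proves the leaf F-N2.SOC, whose closer of record is `SmallBlockRothvoss.MatchingSmallBlockPsdBound_proof`,
constant `δ_R/6384`; not restated here.) -/
theorem matchingBlockPsdBound_holds : Summit.PneNP.MatchingPsdRank.MatchingBlockPsdBound := by
  intro b hb
  obtain ⟨n₀, hn₀⟩ := blockPsd_explicit
  have hδ := δR_pos
  have hb0 : (0 : ℝ) < b := by exact_mod_cast hb
  have hC0 : (0 : ℝ) < 14400 * (b : ℝ) ^ 5 := by positivity
  set κ : ℝ := δR / (798 * (b + 1)) with hκ
  have hκ0 : 0 < κ := by positivity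
  have hα0 : 0 < κ / 2 := by positivity
  obtain ⟨n₁, hn₁⟩ : ∃ n₁ : ℕ, ∀ n ≥ n₁, 2 * (n : ℝ) ^ 2 ≤ (2 : ℝ) ^ (κ / 4 * n - 0) :=
    Filter.eventually_atTop.1 (eventually_two_mul_sq_le_two_rpow (by positivity) 0)
  refine ⟨κ / 2, hα0, max n₀ (max n₁ ⌈14400 * (b : ℝ) ^ 5⌉₊), fun n hn heven r hfac => ?_⟩
  have hnn₀ : n₀ ≤ n := le_trans (le_max_left _ _) hn
  have hnn₁ : n₁ ≤ n := le_trans (le_max_left _ _) (le_trans (le_max_right _ _) hn)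
  have hnC : 14400 * (b : ℝ) ^ 5 ≤ n :=
    (Nat.le_ceil (14400 * (b : ℝ) ^ 5)).trans
      (by exact_mod_cast le_trans (le_max_right _ _) (le_trans (le_max_right _ _) hn))
  have h1 := hn₀ n hnn₀ heven b r hb hfac
  have hexp : δR * n / (798 * (b + 1)) = κ / 2 * n + κ / 2 * n := by rw [hκ]; ring
  rw [hexp, Real.rpow_add (by norm_num)] at h1
  -- `14400 b⁵ n³ ≤ n⁴ ≤ 4 n⁴ = (2n²)² ≤ 2^{κ n / 2}`
  have h2 := hn₁ n hnn₁
  rw [sub_zero] at h2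
  have hn0 : (0 : ℝ) ≤ n := Nat.cast_nonneg n
  have hy0 : 0 < (2 : ℝ) ^ (κ / 2 * n) := Real.rpow_pos_of_pos (by norm_num) _
  have h3 : 14400 * (b : ℝ) ^ 5 * (n : ℝ) ^ 3 ≤ (2 : ℝ) ^ (κ / 2 * n) := by
    have e1 : 14400 * (b : ℝ) ^ 5 * (n : ℝ) ^ 3 ≤ (2 * (n : ℝ) ^ 2) ^ 2 := by
      calc 14400 * (b : ℝ) ^ 5 * (n : ℝ) ^ 3 ≤ n * (n : ℝ) ^ 3 :=
            mul_le_mul_of_nonneg_right hnC (by positivity)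
        _ ≤ (2 * (n : ℝ) ^ 2) ^ 2 := by nlinarith [pow_nonneg hn0 4]
    have e2 : (2 * (n : ℝ) ^ 2) ^ 2 ≤ ((2 : ℝ) ^ (κ / 4 * n)) ^ 2 := pow_le_pow_left₀ (by positivity) h2 2
    have e3 : ((2 : ℝ) ^ (κ / 4 * n)) ^ 2 = (2 : ℝ) ^ (κ / 2 * n) := by
      rw [← Real.rpow_natCast, ← Real.rpow_mul (by norm_num)]; congr 1; push_cast; ring
    linarith [e3 ▸ e2]
  have h4 : (2 : ℝ) ^ (κ / 2 * n) * (2 : ℝ) ^ (κ / 2 * n) ≤ r * (2 : ℝ) ^ (κ / 2 * n) :=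
    h1.trans (mul_le_mul_of_nonneg_left h3 (Nat.cast_nonneg r))
  exact le_of_mul_le_mul_right h4 hy0

end Summit.PneNP.PneNP.Theorems.SmallBlockRothvossBallGrid

end
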